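import Summits.QuantumAdvantage.QuantumAdvantage.Theorems.CubicForrelationNearExactIsExactTwelveTypeO930Dead
import Summits.QuantumAdvantage.QuantumAdvantage.Theorems.CubicForrelationNearExactIsExactTwelveLevelFiveOffFlatGt2932

/-!
# Crux `CubicForrelation.NearExactIsExact` (stmt-QuantumAdvantage-14043) — n = 12, type O with base set `960` at `Φ ≥ 929/1024`: DEAD
  (excess `≤ 384`; the partner identity with a wild term forces the wild function to vanish, i.e. `Φ = 932/1024`, but base `960` has `Φ < 930/1024`)

Certificate seat `b2b-cforr-cert` (gen 20).  HONEST FRAMING: a kernel-checked lemma (standard axioms) about cubic Boolean pairs on 12 bits — one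
configuration of the value `929/1024` on the `n = 12` ladder (with …TwelveTypeO512At929 and …TwelveTypeO992At929 it removes the type-O branch at
`929/1024`).  NO new value of `θ₁₂` by itself.  NOT summit progress.

`to20_typeO_E960_ge929_false`: cubic `f, g`, `W_g = 16u`, some `u` odd, `#E = 960`, `Φ(f,g) ≥ 929/1024` is impossible.  Proof.  Write
`u − 4(−1)^f = τ₀ + 8v` (`to12_pt_mod8`); the excess `X = Σ((τ₀ + 8v)² − τ₀²) = 2¹⁷(1 − Φ) − 11776 ≤ 384` and `(τ₀+8v)² − τ₀² ≥ 16v²` give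
`Σ v² ≤ 24`.  The partner identity WITH the wild term (`to18_typeO_partner_identity`) and the character sums `Ê = 64m′` of a weight-`960` cubic
support (`to18_char_sum_E960`) give `v̂(y) = Σ_x v(x)(−1)^{x·y} = 8k(y)` with `k(y) + u_f(y) ≡ 0 (mod 4)`, `u_f = W_f/16`.  If `u_f` is odd
(everywhere) then `|v̂| ≥ 8` everywhere and Parseval `Σ_y v̂² = 4096·Σv² ≤ 98304 < 4096·64` fails.  So `u_f` is even, `k` is even and
`|v̂| ≤ Σ|v| ≤ 24` gives `k ∈ {0, ±2}`; `k ≡ 2 (mod 4)` exactly where `u_f/2` is odd, a set which is empty or a hyperplane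
(`tw20_hyperplane_gt2932` for `(g, f)`): a hyperplane would carry `Σ v̂² ≥ 2048·256`; so `k ≡ 0`, `v̂ ≡ 0`, `v ≡ 0`, `X = 0`, `Φ = 932/1024` —
contradicting `to19_typeO_E960_ge930_false'` (base `960` lives below `930/1024`).

References: Kasami–Tokura (1970); MacWilliams–Sloane (1977) Ch. 14–15; Carlet (2021) §5.2; O'Donnell (2014) §1.4, §3.3.  Axioms: the standard three.
-/

set_option linter.dupNamespace false -- D-0017: single-problem summit ⇒ `QuantumAdvantage.QuantumAdvantage` by design

noncomputable section

namespace Summit.QuantumAdvantage.QuantumAdvantage.Theorems.CubicForrelation.NearExactIsExact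

open Finset
open Literature.Computability.QuantumComplexity
open Literature.Computability.QuantumComplexity.BuzetChailloux (bxor zeroVec bxor_bxor_cancel_left bxor_zeroVec zeroVec_bxor bxor_comm
  bxor_self twist_zeroVec_right twist_bxor_right)
open Literature.Computability.QuantumComplexity.DerivativeWalsh (W sum_W_sq)
open Literature.Computability.QuantumComplexity.Simon (twist_eq_one_or)
open Summit.QuantumAdvantage.QuantumAdvantage.Theorems.NearExactIsExact.Negative (TypeOTwelve.typeO_of_exists_odd)

/-! ### The wild-function engine: `v̂ = 8k`, `k ≡ −u_f (mod 4)`, `Σ v² ≤ 24` ⇒ `v ≡ 0` -/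

/-- **Wild-function engine.**  `f` cubic, `g` Boolean on 12 bits with `29/32 < Φ(f,g)`, `W_f = 16·u_f`, and an integer function `v` with `Σ v² ≤ 24`
whose transform satisfies `v̂(y) = 8k(y)` with `4 ∣ k(y) + u_f(y)` for every `y`: then `v ≡ 0`.  See the module docstring. [this work] -/
theorem to20_wild_engine (f g : (Fin (6 + 6) → Bool) → Bool) (hf : IsDegLeFun 3 f)
    (hΦ : (29 / 32 : ℝ) < forrelation f g)
    (uf : (Fin (6 + 6) → Bool) → ℤ) (huf : ∀ y, W (fun x => signOf (f x)) y = (2 : ℝ) ^ 4 * (uf y : ℝ))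
    (v : (Fin (6 + 6) → Bool) → ℤ) (hV : ∑ x, v x ^ 2 ≤ 24)
    (k : (Fin (6 + 6) → Bool) → ℤ) (hk : ∀ y, ∑ x, (v x : ℝ) * twist x y = 8 * (k y : ℝ)) (hk4 : ∀ y, (4 : ℤ) ∣ k y + uf y) :
    ∀ x, v x = 0 := by
  classical
  have hΦ' : forrelation g f = forrelation f g := by
    rw [Summit.QuantumAdvantage.QuantumAdvantage.Theorems.SignedCubicForrelationNotPrBPP.Negative.HalfQuad.forrelation_comm]
  -- Parseval for `v`
  have hpars : ∑ y, (∑ x, (v x : ℝ) * twist x y) ^ 2 = 4096 * ∑ x, ((v x : ℝ)) ^ 2 := by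
    have h := sum_W_sq (n := 6 + 6) (fun x => (v x : ℝ))
    unfold W at h
    rw [h]; norm_num
  have hV' : ∑ x, ((v x : ℝ)) ^ 2 ≤ 24 := by
    have : ((∑ x, v x ^ 2 : ℤ) : ℝ) ≤ 24 := by exact_mod_cast hV
    push_cast at this; exact this
  have hk2sum : ∑ y, ((k y : ℝ)) ^ 2 ≤ 1536 := by
    have e : ∑ y, (∑ x, (v x : ℝ) * twist x y) ^ 2 = 64 * ∑ y, ((k y : ℝ)) ^ 2 := by
      rw [mul_sum]; exact sum_congr rfl fun y _ => by rw [hk y]; ring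
    rw [e] at hpars
    nlinarith
  -- `|v̂| ≤ Σ|v| ≤ Σ v²`, so `|k| ≤ 3`
  have hkabs : ∀ y, |k y| ≤ 3 := by
    intro y
    have h1 : |∑ x, (v x : ℝ) * twist x y| ≤ 24 := by
      calc |∑ x, (v x : ℝ) * twist x y| ≤ ∑ x, |(v x : ℝ) * twist x y| := abs_sum_le_sum_abs _ _
        _ = ∑ x, |(v x : ℝ)| := sum_congr rfl fun x _ => by
            rw [abs_mul]; rcases twist_eq_one_or x y with h | h <;> rw [h] <;> simp
        _ ≤ ∑ x, ((v x : ℝ)) ^ 2 := sum_le_sum fun x _ => by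
            rw [← Int.cast_abs]
            have habs : |v x| ≤ v x ^ 2 := by
              rcases le_or_gt 0 (v x) with h | h
              · rw [abs_of_nonneg h]; nlinarith
              · rw [abs_of_neg h]; nlinarith
            exact_mod_cast habs
        _ ≤ 24 := hV'
    rw [hk y, abs_mul, abs_of_nonneg (by norm_num : (0:ℝ) ≤ 8)] at h1
    have : |(k y : ℝ)| ≤ 3 := by linarith
    rw [← Int.cast_abs] at this
    exact_mod_cast this
  -- a set of `N` points with `k² ≥ c` costs `c·N ≤ 1536`
  have hbig : ∀ (S : Finset (Fin (6 + 6) → Bool)) (c : ℝ), 0 ≤ c → (∀ y ∈ S, c ≤ ((k y : ℝ)) ^ 2) → c * #S ≤ 1536 := by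
    intro S c hc hS
    have h1 : ∑ y ∈ S, c ≤ ∑ y ∈ S, ((k y : ℝ)) ^ 2 := sum_le_sum hS
    rw [sum_const, nsmul_eq_mul, mul_comm] at h1
    have h2 : ∑ y ∈ S, ((k y : ℝ)) ^ 2 ≤ ∑ y, ((k y : ℝ)) ^ 2 :=
      sum_le_sum_of_subset_of_nonneg (subset_univ S) fun y _ _ => sq_nonneg _
    linarith
  by_cases hO : ∃ y, Odd (uf y)
  · -- all `u_f` odd, so all `k` odd: `k² ≥ 1` at `4096` points
    exfalso
    obtain ⟨y₁, hy₁⟩ := hO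
    have hdeg := stub_walshTower stub_axParity (6 + 6) 4 0 f uf hf huf (by intro j hj hjn; omega)
    have hallodd : ∀ y, Odd (uf y) := by
      intro y
      have h := tc_const_of_deg_zero hdeg y y₁
      have h1 : decide (Odd (uf y₁)) = true := by simpa using hy₁
      rw [h1] at h
      simpa using h
    have hk1 : ∀ y ∈ (univ : Finset (Fin (6 + 6) → Bool)), (1 : ℝ) ≤ ((k y : ℝ)) ^ 2 := by
      intro y _
      obtain ⟨j, hj⟩ := hk4 y
      have h0 := Int.odd_iff.1 (hallodd y)
      have : k y ≤ -1 ∨ 1 ≤ k y := by omega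
      have hsq := tp_sq_ge (k := 1) (by norm_num) this
      exact_mod_cast hsq
    have := hbig univ 1 (by norm_num) hk1
    rw [card_univ, Fintype.card_fun, Fintype.card_bool, Fintype.card_fin] at this
    norm_num at this
  · push Not at hO
    -- `u_f` even: level `≥ 5`
    have huf5 := tw_level_up (j := 4) f uf huf hO
    have hev2 : ∀ y, uf y = 2 * (uf y / 2) := fun y =>
      (Int.mul_ediv_cancel' (even_iff_two_dvd.1 (Int.not_odd_iff_even.1 (hO y)))).symm
    by_cases hO5 : ∃ y, Odd (uf y / 2)
    · -- the odd set of `u_f/2` is a hyperplane carrying `k = ±2`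
      exfalso
      obtain ⟨γ', t', ht', hγ'0, hPf⟩ := tw20_hyperplane_gt2932 g f hf (fun y => uf y / 2) huf5 hO5 (by rw [hΦ']; exact hΦ)
      have hcard := tw59_card_half γ' hγ'0 t' ht'
      have h4 : ∀ y ∈ univ.filter (fun y : Fin (6 + 6) → Bool => twist γ' y = t'), (4 : ℝ) ≤ ((k y : ℝ)) ^ 2 := by
        intro y hy
        have hyo : Odd (uf y / 2) := (hPf y).2 (mem_filter.1 hy).2
        obtain ⟨j, hj⟩ := hk4 y
        have h0 := Int.odd_iff.1 hyo
        have h2 := hev2 y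
        have : k y ≤ -2 ∨ 2 ≤ k y := by omega
        have hsq := tp_sq_ge (k := 2) (by norm_num) this
        have : (4 : ℤ) ≤ k y ^ 2 := by linarith
        exact_mod_cast this
      have := hbig _ 4 (by norm_num) h4
      rw [hcard] at this
      norm_num at this
    · push Not at hO5
      -- `4 ∣ u_f`, so `4 ∣ k`, `|k| ≤ 3`: `k ≡ 0`, `v̂ ≡ 0`, `v ≡ 0`
      have hk0 : ∀ y, k y = 0 := by
        intro y
        obtain ⟨j, hj⟩ := hk4 y
        have h2 := hev2 y
        have h4 : uf y / 2 = 2 * (uf y / 2 / 2) :=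
          (Int.mul_ediv_cancel' (even_iff_two_dvd.1 (Int.not_odd_iff_even.1 (hO5 y)))).symm
        have hk3 := hkabs y
        rw [abs_le] at hk3
        omega
      have hvhat0 : ∑ y, (∑ x, (v x : ℝ) * twist x y) ^ 2 = 0 :=
        sum_eq_zero fun y _ => by rw [hk y, hk0 y]; norm_num
      rw [hpars] at hvhat0
      have hsum0 : ∑ x, ((v x : ℝ)) ^ 2 = 0 := by linarith
      intro x
      have := (sum_eq_zero_iff_of_nonneg fun z _ => sq_nonneg ((v z : ℝ))).1 hsum0 x (mem_univ x)
      exact_mod_cast pow_eq_zero_iff two_ne_zero |>.1 this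

/-! ### Base set `960` at `Φ ≥ 929/1024` -/

/-- **No type-O side with base set `960` at `Φ ≥ 929/1024`** (12 bits).  See the module docstring.  Finite-slice statement, NOT summit
progress. [this work] -/
theorem to20_typeO_E960_ge929_false (f g : (Fin (6 + 6) → Bool) → Bool) (hf : IsDegLeFun 3 f) (hg : IsDegLeFun 3 g)
    (u : (Fin (6 + 6) → Bool) → ℤ) (hu : ∀ x, W (fun y => signOf (g y)) x = (2 : ℝ) ^ 4 * (u x : ℝ))
    (hodd : ∃ x, Odd (u x)) (hE : #(univ.filter fun x : Fin (6 + 6) → Bool => (Odd (u x / 2) ↔ Odd (u x / 2 / 2))) = 960)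
    (hΦ : (929 / 1024 : ℝ) ≤ forrelation f g) : False := by
  classical
  have hall : ∀ x, Odd (u x) := TypeOTwelve.typeO_of_exists_odd g u hg hu hodd
  have hu' : ∀ x, W (fun y => signOf (g y)) x = (2 : ℝ) ^ (2 * 2) * (u x : ℝ) := fun x => (hu x).trans (by norm_num)
  have hd1 : IsDegLeFun 1 (fun x => decide (Odd (u x / 2))) := z2_digitOne 2 g u hg hu' hall
  have hd2 : IsDegLeFun 3 (fun x => decide (Odd (u x / 2 / 2))) := z2_digitTwo 2 g u hg hu' hall
  obtain ⟨c₁, b₁, hcb⟩ := stub_affineForm (6 + 6) _ hd1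
  set E := univ.filter (fun x : Fin (6 + 6) → Bool => (Odd (u x / 2) ↔ Odd (u x / 2 / 2))) with hEdef
  have hmemE : ∀ x, x ∈ E ↔ (Odd (u x / 2) ↔ Odd (u x / 2 / 2)) := fun x => by simp [hEdef]
  have hdegE : IsDegLeFun (2 + 1) (fun x => (decide (Odd (u x / 2)) ^^ decide (Odd (u x / 2 / 2))) ^^ true) :=
    tb_isDegLeFun_xor_const (bb_isDegLeFun_bxor (hd1.mono (by norm_num)) hd2) true
  have hsetE : (univ.filter fun x : Fin (6 + 6) → Bool =>
      ((decide (Odd (u x / 2)) ^^ decide (Odd (u x / 2 / 2))) ^^ true) = true) = E := by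
    rw [hEdef]
    apply filter_congr
    intro x _
    by_cases h1 : Odd (u x / 2) <;> by_cases h2 : Odd (u x / 2 / 2) <;> simp [h1, h2]
  -- not at `Φ ≥ 930/1024`, and `Φ < 1`
  have hlt930 : forrelation f g < 930 / 1024 := by
    by_contra h; push Not at h
    exact to19_typeO_E960_ge930_false' f g hf hg u hu hodd hE h
  -- budget: `Σ τ² = 2¹⁷(1 − Φ) ≤ 12160`
  obtain ⟨-, -, hbud⟩ := to19_typeO_gt2932_shape f g hf hg u hu hodd (by linarith)
  have hT : (∑ x, (u x - 4 * sZ (f x)) ^ 2 : ℤ) ≤ 12160 := by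
    have h' : ((∑ x, (u x - 4 * sZ (f x)) ^ 2 : ℤ) : ℝ) ≤ 12160 := by rw [hbud]; linarith
    exact_mod_cast h'
  -- wild decomposition `τ = τ₀ + 8v`
  choose v hv using fun x => to12_pt_mod8 (u x) (sZ (f x)) (hall x) (tp_sZ_cases (f x))
  set τ₀ : (Fin (6 + 6) → Bool) → ℤ := fun x =>
    sZ (decide (Odd (u x / 2))) * (1 - 4 * (if (Odd (u x / 2) ↔ Odd (u x / 2 / 2)) then 1 else 0)) with hτ₀def
  have hτ₀val : ∀ x, τ₀ x = 1 ∨ τ₀ x = -1 ∨ τ₀ x = 3 ∨ τ₀ x = -3 := by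
    intro x
    simp only [τ₀]
    rcases tp_sZ_cases (decide (Odd (u x / 2))) with h | h <;> rw [h] <;> split_ifs <;> norm_num
  have hτ₀sq : ∀ x, τ₀ x ^ 2 = 1 + 8 * (if (Odd (u x / 2) ↔ Odd (u x / 2 / 2)) then 1 else 0 : ℤ) := by
    intro x
    simp only [τ₀]
    rcases tp_sZ_cases (decide (Odd (u x / 2))) with h | h <;> rw [h] <;> split_ifs <;> norm_num
  have hsumE : (∑ x, (if (Odd (u x / 2) ↔ Odd (u x / 2 / 2)) then 1 else 0 : ℤ)) = #E := by rw [sum_boole]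
  have hsumτ₀ : ∑ x, τ₀ x ^ 2 = 11776 := by
    rw [sum_congr rfl fun x _ => hτ₀sq x, sum_add_distrib, ← mul_sum, hsumE, sum_const, card_univ, Fintype.card_fun,
      Fintype.card_bool, Fintype.card_fin, hE]
    norm_num
  have hX16 : ∀ x, 16 * v x ^ 2 ≤ (τ₀ x + 8 * v x) ^ 2 - τ₀ x ^ 2 := by
    intro x
    have ht : -3 ≤ τ₀ x ∧ τ₀ x ≤ 3 := by rcases hτ₀val x with h | h | h | h <;> rw [h] <;> norm_num
    have key : 0 ≤ v x * (3 * v x + τ₀ x) := by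
      rcases lt_trichotomy (v x) 0 with hlt | heq | hgt
      · have h1 : 3 * v x + τ₀ x ≤ 0 := by linarith
        nlinarith
      · rw [heq]; simp
      · have h1 : 0 ≤ 3 * v x + τ₀ x := by linarith
        exact mul_nonneg hgt.le h1
    nlinarith [key]
  have hV : ∑ x, v x ^ 2 ≤ 24 := by
    have hTdec : (∑ x, (u x - 4 * sZ (f x)) ^ 2 : ℤ) = ∑ x, τ₀ x ^ 2 + ∑ x, ((τ₀ x + 8 * v x) ^ 2 - τ₀ x ^ 2) := by
      rw [← sum_add_distrib]; exact sum_congr rfl fun x _ => by rw [hv x]; ring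
    have h1 : 16 * ∑ x, v x ^ 2 ≤ ∑ x, ((τ₀ x + 8 * v x) ^ 2 - τ₀ x ^ 2) := by
      rw [mul_sum]; exact sum_le_sum fun x _ => hX16 x
    linarith
  -- the partner and the wild identity
  obtain ⟨uf, huf⟩ := tw_base (n := 6 + 6) f hf 4 (by norm_num)
  have hid : ∀ y, 64 * (uf y : ℝ) = 256 * signOf (g y) -
      signOf b₁ * ((if bxor c₁ y = (fun _ => false) then (2 : ℝ) ^ (6 + 6) else 0) - 4 * ∑ x ∈ E, twist x (bxor c₁ y)) -
      8 * ∑ x, (v x : ℝ) * twist x y := by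
    intro y
    have h := to18_typeO_partner_identity f g u hu v hv c₁ b₁ hcb uf huf y
    rw [← hEdef] at h
    exact h
  have hsb : ((sZ b₁ : ℤ) : ℝ) = signOf b₁ := tp_sZ_cast _
  -- `v̂ = 8k` with `k = 4(−1)^g − 64(−1)^{b₁}[y = c₁] + 4(−1)^{b₁} m′ − u_f`
  have hk : ∀ y, ∃ k : ℤ, (∑ x, (v x : ℝ) * twist x y) = 8 * (k : ℝ) ∧ (4 : ℤ) ∣ k + uf y := by
    intro y
    obtain ⟨m', -, hm'⟩ := to18_char_sum_E960 _ hdegE (by rw [hsetE]; exact hE) (bxor c₁ y)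
    rw [hsetE] at hm'
    have h := hid y
    rw [hm'] at h
    by_cases hz : bxor c₁ y = (fun _ => false)
    · rw [if_pos hz] at h
      refine ⟨4 * sZ (g y) - 64 * sZ b₁ + 4 * sZ b₁ * m' - uf y, ?_, ⟨sZ (g y) - 16 * sZ b₁ + sZ b₁ * m', by ring⟩⟩
      push_cast; rw [tp_sZ_cast, hsb]
      have e4096 : (2 : ℝ) ^ (6 + 6) = 4096 := by norm_num
      rw [e4096] at h
      linarith
    · rw [if_neg hz] at h
      refine ⟨4 * sZ (g y) + 4 * sZ b₁ * m' - uf y, ?_, ⟨sZ (g y) + sZ b₁ * m', by ring⟩⟩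
      push_cast; rw [tp_sZ_cast, hsb]
      linarith
  choose k hk8 hk4 using hk
  have hv0 := to20_wild_engine f g hf (by linarith) uf huf v hV k hk8 hk4
  -- so the excess vanishes and `Φ = 932/1024`
  have hTeq : (∑ x, (u x - 4 * sZ (f x)) ^ 2 : ℤ) = 11776 := by
    rw [← hsumτ₀]; exact sum_congr rfl fun x _ => by rw [hv x, hv0 x]; ring
  have h : ((∑ x, (u x - 4 * sZ (f x)) ^ 2 : ℤ) : ℝ) = 11776 := by exact_mod_cast hTeq
  rw [hbud] at h
  linarith

end Summit.QuantumAdvantage.QuantumAdvantage.Theorems.CubicForrelation.NearExactIsExact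

end
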